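/-
Copyright (c) 2026 The HCML crux team. All rights reserved.
Released under Apache 2.0 license as described in the file LICENSE.
Authors: K2E3-p03 (g5) (explicit-unit `hodgecm-mathlib-K2E3-p03-g5`)
-/
import Summits.HodgeConjecture.HodgeConjecture.Theorems.K2E3GL3LeviHaarCoordinates   -- ★ file 1 (this seat): `exists_lintegral_levi_eq_mul_lintegral_pi` (Haar on `M₍₂,₁₎` in `F⁵` coordinates)
import Summits.HodgeConjecture.HodgeConjecture.Theorems.K2E3GL3ParabolicSliceFubini   -- ★ p21 (g4): `lintegral_pi_fin_seven_eq`; brings ★ `K2E3GL3ParabolicNilTwist` (`boxEquiv_exists`), ★ `exists_haar_eq_smul_map_box`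
import Literature.MeasureTheory.Group.LocalFieldLinearJacobian                       -- ★ `lintegral_comp_linearEquiv` (`∫ f(L y) dy = mod_F(det L)⁻¹ ∫ f`)
import HarnessLib

/-!
# (11-3-split-nsc, brick (nsc-K𝔭-MU), file 2 of 2) Levi × unipotent coordinates of the (2,1) parabolic of `GL₃(F)`:
# `∫_M ∫_U g(m u) dμ_U dν_M = c ∫_{F⁷} 1_{det A ≠ 0, b ≠ 0} g(!![A, x; 0, b]) (‖det A‖⁻¹)³ ‖b‖⁻¹ d(A, x, b)`

Cell `hodgecm-mathlib`, Track B, line `K2_E3_EllipticInputs`; leaf (11-3-split-nsc) `sig_K2E3CharLocIntNearSemisimpleSplitThreeNonSupercuspidal` (U12 ED. 20),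
road owner K2E3-p11 (g5 → g6) (BRICK LIST v1.1, squad bus 2026-09-04T07:55:03Z, brick (nsc-K𝔭-MU)), dealer K2E3-plan (g3).  `--supports stmt-HodgeConjecture-24833 --as helper`;
THEOREMS ONLY (no definition ∕ instance ∕ notation ∕ named fact ∕ `sorry`); never imports `Cruxes/…/Lines`.  COUNT-NEUTRAL: the brick that reads the inner double integral of
van Dijk's `K M U` character formula (★ `GLn.exists_smoothTrace_parabolicIndGL_eq_integral_KMU`) for `P = P₍₂,₁₎ = M ⋉ U ⊂ GL₃(F)` on the additive parameter space `𝔭 ≅ F⁷` of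
the (F-E) road (★ `K2E3GL3ParabolicSliceFubini`), where the domination by the slice density (★ H″6) lives — brick (nsc-K𝔭-D) composes the two.

THE RESULT.  `M = standardLeviGL F ![false,false,true] = {diag(A, b)}`, `U = unipotentRadicalGL F ![false,false,true] = {n(y) = !![1,0,y₀; 0,1,y₁; 0,0,1]}`, Haar measures
`ν_M`, `μ_U`, additive Haar `dx` on `F`, `P(r) = !![r₀,r₁,r₂; r₃,r₄,r₅; 0,0,r₆]`, `A(r) = !![r₀,r₁; r₃,r₄]`:
**`exists_lintegral_levi_unipotent_eq_mul_lintegral_pi`** — there is ONE `c ∈ (0, ∞)` with, for every Borel `g : M₃(F) → [0, ∞]`,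
`∫⁻ m, ∫⁻ u, g(↑(m·u)) dμ_U dν_M = c ∫⁻_{r ∈ F⁷} 1_{det A(r) ≠ 0 ∧ r₆ ≠ 0} g(P(r)) (‖det A(r)‖_F⁻¹)³ ‖r₆‖_F⁻¹ d(⊗₇ dx)`.
PROOF.  `∫_U g(X·u) dμ_U = C₀ ∫_{F²} g(X·n(y)) dy` (★ box chart of `U`, `μ_U = C₀ Φ_*(dy)`; §1), `∫_M ψ dν_M = c₁ ∫_{F⁵} 1·ψ(diag(A,b))·(‖det A‖⁻¹)²‖b‖⁻¹` (★ file 1),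
`diag(A, b)·n(y) = P(A, A y, b)` and the substitution `x = A y` costs `‖det A‖⁻¹` (★ `lintegral_comp_linearEquiv`, ★ `distribHaarChar_eq_normAbs`; §2), then `F⁵ × F² = F⁷`
(★ `lintegral_pi_fin_seven_eq`).  So `(‖det A‖⁻¹)² · ‖det A‖⁻¹ = (‖det A‖⁻¹)³`: the LEFT Haar measure of `P` in the coordinates `P(r)`.
[WeilBNT1967, Chap. II §1; BernsteinZelevinsky1977, §2.1 (`P = M ⋉ U`); vanDijk1972, §2; HarishChandra1999AdmissibleDistributions, §7 Lemma 7.8]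
HONEST LABEL: HC_CM is proved only modulo the 7 printed citations (2 remaining named inputs: hLiu418 = stmt-HodgeConjecture-24832, h413 =
stmt-HodgeConjecture-24833) until rung 0 closes; count-neutral helper.

## References
* [WeilBNT1967] A. Weil, *Basic Number Theory* (1967), Chap. I §2, Chap. II §1.
* [BernsteinZelevinsky1977] I. N. Bernstein, A. V. Zelevinsky, *Induced representations of reductive 𝔭-adic groups I*, Ann. Sci. ÉNS 10 (1977), §2.1.
* [vanDijk1972] G. van Dijk, *Computation of certain induced characters of 𝔭-adic groups*, Math. Ann. 199 (1972), §2.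
* [HarishChandra1999AdmissibleDistributions] Harish-Chandra (DeBacker–Sally), AMS ULECT 16 (1999), §7 Lemma 7.8.
-/

set_option autoImplicit false
set_option linter.dupNamespace false

noncomputable section

open MeasureTheory MeasureTheory.Measure Topology TopologicalSpace Matrix
open scoped MatrixGroups NNReal ENNReal
open Literature.NumberTheory.Automorphic Literature.NumberTheory.Weil1964
open Literature.NumberTheory.GaloisRepresentations Literature.NumberTheory.GaloisRepresentations.IsNonarchimedeanLocalField
open Summit.HodgeConjecture.HodgeConjecture.Cruxes.H413.K2E3GL3MinimalRichardsonFourier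
open Summit.HodgeConjecture.HodgeConjecture.Cruxes.H413.K2E3GL3ParabolicNilTwist
open Summit.HodgeConjecture.HodgeConjecture.Cruxes.H413.K2E3GL3ParabolicSliceFubini
open Summit.HodgeConjecture.HodgeConjecture.Cruxes.H413.K2E3GL3LeviHaarCoordinates

namespace Summit.HodgeConjecture.HodgeConjecture.Cruxes.H413.K2E3GL3ParabolicLeviUnipotentCoordinates

variable {F : Type*} [Field F] [ValuativeRel F] [TopologicalSpace F] [IsNonarchimedeanLocalField F]
  [MeasurableSpace F] [BorelSpace F] [MeasurableSpace (Matrix (Fin 3) (Fin 3) F)] [BorelSpace (Matrix (Fin 3) (Fin 3) F)]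

/-! ## §1  The unipotent radical `U ≅ F²`: `∫_U g(X·u) dμ_U = C₀ ∫_{F²} g(X·n(y)) dy` -/

omit [ValuativeRel F] [TopologicalSpace F] [IsNonarchimedeanLocalField F] [MeasurableSpace F] [BorelSpace F]
  [MeasurableSpace (Matrix (Fin 3) (Fin 3) F)] [BorelSpace (Matrix (Fin 3) (Fin 3) F)] in
/-- `diag-block(v) · n(y) = P(v, A(v) y)`: `!![v₀,v₁,0; v₂,v₃,0; 0,0,v₄] · !![1,0,y₀; 0,1,y₁; 0,0,1] = !![v₀, v₁, v₀y₀+v₁y₁; v₂, v₃, v₂y₀+v₃y₁; 0, 0, v₄]`. [folklore] -/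
theorem leviMatrix_mul_unipotentMatrix (v : Fin 5 → F) (y : Fin 2 → F) :
    (!![v 0, v 1, 0; v 2, v 3, 0; 0, 0, v 4] : Matrix (Fin 3) (Fin 3) F) * !![1, 0, y 0; 0, 1, y 1; 0, 0, 1] =
      !![v 0, v 1, ((!![v 0, v 1; v 2, v 3] : Matrix (Fin 2) (Fin 2) F).mulVec y) 0; v 2, v 3, ((!![v 0, v 1; v 2, v 3] : Matrix (Fin 2) (Fin 2) F).mulVec y) 1; 0, 0, v 4] := by
  ext i j
  fin_cases i <;> fin_cases j <;> simp [Matrix.mul_apply, Fin.sum_univ_succ, Matrix.mulVec, dotProduct]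

/-- **`∫_U g(X · u) dμ_U = C₀ ∫_{F²} g(X · n(y)) dy`** for every `X ∈ M₃(F)` and Borel `g ≥ 0`, with ONE `C₀ ∈ (0, ∞)`: the Haar measure of `U` in the box chart
`y ↦ n(y) = !![1,0,y₀; 0,1,y₁; 0,0,1]` (★ `exists_haar_eq_smul_map_box`, ★ `boxEquiv_exists`). [cite: BernsteinZelevinsky1977, §2.1] [cite: WeilBNT1967, Chap. II §1] -/
theorem exists_lintegral_unipotent_eq_mul_lintegral_pi
    [MeasurableSpace ↥(unipotentRadicalGL F (![false, false, true] : Fin 3 → Bool))] [BorelSpace ↥(unipotentRadicalGL F (![false, false, true] : Fin 3 → Bool))]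
    (μU : Measure ↥(unipotentRadicalGL F (![false, false, true] : Fin 3 → Bool))) [IsHaarMeasure μU] (dx : Measure F) [dx.IsAddHaarMeasure] :
    ∃ C₀ : ℝ≥0∞, C₀ ≠ 0 ∧ C₀ ≠ ∞ ∧ ∀ (X : Matrix (Fin 3) (Fin 3) F) (g : Matrix (Fin 3) (Fin 3) F → ℝ≥0∞), Measurable g →
      ∫⁻ u, g (X * ((u : GL (Fin 3) F) : Matrix (Fin 3) (Fin 3) F)) ∂μU = C₀ * ∫⁻ y : Fin 2 → F, g (X * !![1, 0, y 0; 0, 1, y 1; 0, 0, 1]) ∂(Measure.pi fun _ : Fin 2 => dx) := by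
  classical
  haveI : T2Space F := (isLocalField F).toT2Space
  haveI : LocallyCompactSpace F := (isLocalField F).toLocallyCompactSpace
  haveI : SecondCountableTopology F := secondCountableTopology_localField F
  haveI : IsTopologicalRing F := inferInstance
  obtain ⟨Φ, hΦ, C₀, hC₀, hμU⟩ := exists_haar_eq_smul_map_box (F := F) (c := (![false, false, true] : Fin 3 → Bool)) dx μU
  obtain ⟨e, he0, he1⟩ := boxEquiv_exists
  set ε := MeasurableEquiv.piCongrLeft (fun _ : {i : Fin 3 // (![false, false, true] : Fin 3 → Bool) i = false} ×
    {j : Fin 3 // (![false, false, true] : Fin 3 → Bool) j = true} => F) e with hεdef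
  have hε : MeasurePreserving ε (Measure.pi fun _ : Fin 2 => dx) (Measure.pi fun _ => dx) := by
    rw [hεdef]; exact measurePreserving_piCongrLeft (fun _ => dx) e
  have hεapp : ∀ (r : Fin 2 → F) (k : Fin 2), ε r (e k) = r k := fun r k => by
    rw [hεdef]; exact MeasurableEquiv.piCongrLeft_apply_apply (β := fun _ => F) e r k
  have hcoe : ∀ r : Fin 2 → F, (((Φ (ε r) : ↥(unipotentRadicalGL F (![false, false, true] : Fin 3 → Bool))) : GL (Fin 3) F) : Matrix (Fin 3) (Fin 3) F) =
      !![1, 0, r 0; 0, 1, r 1; 0, 0, 1] := fun r => by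
    ext i j
    rw [hΦ]
    have h0 : ε r (⟨0, rfl⟩, ⟨2, rfl⟩) = r 0 := by rw [← he0]; exact hεapp r 0
    have h1 : ε r (⟨1, rfl⟩, ⟨2, rfl⟩) = r 1 := by rw [← he1]; exact hεapp r 1
    fin_cases i <;> fin_cases j <;> simp [h0, h1]
  refine ⟨(C₀ : ℝ≥0∞), ENNReal.coe_ne_zero.2 hC₀, ENNReal.coe_ne_top, fun X g hg => ?_⟩
  have hmeas : Measurable fun u : ↥(unipotentRadicalGL F (![false, false, true] : Fin 3 → Bool)) => g (X * ((u : GL (Fin 3) F) : Matrix (Fin 3) (Fin 3) F)) :=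
    hg.comp (continuous_const.mul (Units.continuous_val.comp continuous_subtype_val)).measurable
  rw [hμU, lintegral_smul_measure, lintegral_map hmeas Φ.continuous.measurable, ENNReal.smul_def, smul_eq_mul,
    ← hε.lintegral_comp (f := fun x => g (X * (((Φ x : ↥(unipotentRadicalGL F (![false, false, true] : Fin 3 → Bool))) : GL (Fin 3) F) : Matrix (Fin 3) (Fin 3) F)))
      (hmeas.comp Φ.continuous.measurable)]
  congr 1
  refine lintegral_congr fun r => ?_
  show g _ = g _
  rw [hcoe]

/-! ## §2  The brick: `∫_M ∫_U g(m u) dμ_U dν_M` in the coordinates `P(r)`, `r ∈ F⁷` -/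

/-- **(nsc-K𝔭-MU) LEVI × UNIPOTENT COORDINATES OF `P₍₂,₁₎ ⊂ GL₃(F)`.**  For Haar measures `ν_M` on `M = standardLeviGL F ![false,false,true]`, `μ_U` on
`U = unipotentRadicalGL F ![false,false,true]` and an additive Haar measure `dx` on `F` there is ONE `c ∈ (0, ∞)` with, for every Borel `g : M₃(F) → [0, ∞]`:
`∫⁻ m, ∫⁻ u, g(↑(m u)) dμ_U dν_M = c ∫⁻_{r ∈ F⁷} 1_{det A(r) ≠ 0 ∧ r₆ ≠ 0} g(!![r₀,r₁,r₂; r₃,r₄,r₅; 0,0,r₆]) (‖det A(r)‖_F⁻¹)³ ‖r₆‖_F⁻¹ d(⊗₇ dx)`, `A(r) = !![r₀,r₁; r₃,r₄]`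
— the left Haar measure of `P = M U` read on `𝔭 ≅ F⁷`. [cite: WeilBNT1967, Chap. II §1] [cite: BernsteinZelevinsky1977, §2.1] [cite: vanDijk1972, §2] -/
theorem exists_lintegral_levi_unipotent_eq_mul_lintegral_pi
    [MeasurableSpace ↥(standardLeviGL F (![false, false, true] : Fin 3 → Bool))] [BorelSpace ↥(standardLeviGL F (![false, false, true] : Fin 3 → Bool))]
    [MeasurableSpace ↥(unipotentRadicalGL F (![false, false, true] : Fin 3 → Bool))] [BorelSpace ↥(unipotentRadicalGL F (![false, false, true] : Fin 3 → Bool))]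
    (νM : Measure ↥(standardLeviGL F (![false, false, true] : Fin 3 → Bool))) [IsHaarMeasure νM]
    (μU : Measure ↥(unipotentRadicalGL F (![false, false, true] : Fin 3 → Bool))) [IsHaarMeasure μU] (dx : Measure F) [dx.IsAddHaarMeasure] :
    ∃ c : ℝ≥0∞, c ≠ 0 ∧ c ≠ ∞ ∧ ∀ g : Matrix (Fin 3) (Fin 3) F → ℝ≥0∞, Measurable g →
      ∫⁻ m, ∫⁻ u, g ((((m : GL (Fin 3) F) * (u : GL (Fin 3) F) : GL (Fin 3) F)) : Matrix (Fin 3) (Fin 3) F) ∂μU ∂νM =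
        c * ∫⁻ r : Fin 7 → F, {r : Fin 7 → F | (!![r 0, r 1; r 3, r 4] : Matrix (Fin 2) (Fin 2) F).det ≠ 0 ∧ r 6 ≠ 0}.indicator
          (fun r => g !![r 0, r 1, r 2; r 3, r 4, r 5; 0, 0, r 6] *
            (((normAbs F ((!![r 0, r 1; r 3, r 4] : Matrix (Fin 2) (Fin 2) F).det)⁻¹ : ℝ≥0) : ℝ≥0∞) ^ 3 * ((normAbs F (r 6)⁻¹ : ℝ≥0) : ℝ≥0∞))) r
          ∂(Measure.pi fun _ : Fin 7 => dx) := by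
  classical
  haveI : T2Space F := (isLocalField F).toT2Space
  haveI : LocallyCompactSpace F := (isLocalField F).toLocallyCompactSpace
  haveI : SecondCountableTopology F := secondCountableTopology_localField F
  haveI : IsTopologicalRing F := inferInstance
  haveI : SFinite dx := inferInstance
  obtain ⟨C₀, hC₀0, hC₀top, hU⟩ := exists_lintegral_unipotent_eq_mul_lintegral_pi (F := F) μU dx
  obtain ⟨c₁, hc₁0, hc₁top, hM⟩ := exists_lintegral_levi_eq_mul_lintegral_pi (F := F) νM dx
  refine ⟨c₁ * C₀, mul_ne_zero hc₁0 hC₀0, ENNReal.mul_ne_top hc₁top hC₀top, fun g hg => ?_⟩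
  -- the unipotent matrix and the parabolic matrix as continuous functions of the coordinates
  have hn : Continuous fun y : Fin 2 → F => (!![1, 0, y 0; 0, 1, y 1; 0, 0, 1] : Matrix (Fin 3) (Fin 3) F) := by
    refine continuous_matrix fun i j => ?_
    fin_cases i <;> fin_cases j <;> simp <;> fun_prop
  have hjoint : Measurable fun p : Matrix (Fin 3) (Fin 3) F × (Fin 2 → F) => g (p.1 * !![1, 0, p.2 0; 0, 1, p.2 1; 0, 0, 1]) :=
    hg.comp (continuous_fst.mul (hn.comp continuous_snd)).measurable
  -- STEP 1: integrate out `U` in the box chart; the Levi integrand `ψ(X) = C₀ ∫ g(X n(y)) dy` is Borel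
  set ψ : Matrix (Fin 3) (Fin 3) F → ℝ≥0∞ := fun X => C₀ * ∫⁻ y : Fin 2 → F, g (X * !![1, 0, y 0; 0, 1, y 1; 0, 0, 1]) ∂(Measure.pi fun _ : Fin 2 => dx) with hψ
  have hψm : Measurable ψ := (hjoint.lintegral_prod_right').const_mul _
  have h1 : ∫⁻ m, ∫⁻ u, g ((((m : GL (Fin 3) F) * (u : GL (Fin 3) F) : GL (Fin 3) F)) : Matrix (Fin 3) (Fin 3) F) ∂μU ∂νM =
      ∫⁻ m, ψ ((m : GL (Fin 3) F) : Matrix (Fin 3) (Fin 3) F) ∂νM := by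
    refine lintegral_congr fun m => ?_
    simp_rw [Units.val_mul]
    exact hU _ g hg
  -- STEP 2: the Levi in coordinates (★ file 1)
  have h2 := hM ψ hψm
  -- STEP 3: at fixed `v ∈ F⁵` with `det A(v) ≠ 0`: `diag(v) n(y) = P(v, A(v) y)` and the substitution `x = A(v) y`
  set P7 : (Fin 5 → F) → (Fin 2 → F) → ℝ≥0∞ := fun v x => g !![v 0, v 1, x 0; v 2, v 3, x 1; 0, 0, v 4] with hP7
  have hP7c : Continuous fun q : (Fin 5 → F) × (Fin 2 → F) => (!![q.1 0, q.1 1, q.2 0; q.1 2, q.1 3, q.2 1; 0, 0, q.1 4] : Matrix (Fin 3) (Fin 3) F) := by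
    refine continuous_matrix fun i j => ?_
    fin_cases i <;> fin_cases j <;> simp <;> fun_prop
  have hP7m : Measurable fun q : (Fin 5 → F) × (Fin 2 → F) => P7 q.1 q.2 := hg.comp hP7c.measurable
  have h3 : ∀ v : Fin 5 → F, (!![v 0, v 1; v 2, v 3] : Matrix (Fin 2) (Fin 2) F).det ≠ 0 →
      ∫⁻ y : Fin 2 → F, g (!![v 0, v 1, 0; v 2, v 3, 0; 0, 0, v 4] * !![1, 0, y 0; 0, 1, y 1; 0, 0, 1]) ∂(Measure.pi fun _ : Fin 2 => dx) =
        (normAbs F ((!![v 0, v 1; v 2, v 3] : Matrix (Fin 2) (Fin 2) F).det)⁻¹ : ℝ≥0) * ∫⁻ x : Fin 2 → F, P7 v x ∂(Measure.pi fun _ : Fin 2 => dx) := by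
    intro v hv
    set A : Matrix (Fin 2) (Fin 2) F := !![v 0, v 1; v 2, v 3] with hA
    have hAunit : IsUnit A.det := isUnit_iff_ne_zero.2 hv
    set L : (Fin 2 → F) ≃ₗ[F] (Fin 2 → F) := A.toLinearEquiv' (Matrix.invertibleOfIsUnitDet A hAunit) with hL
    have hLapp : ∀ y, L y = A.mulVec y := fun y => by
      show (L : Module.End F (Fin 2 → F)) y = _
      rw [hL, Matrix.toLinearEquiv'_apply, Matrix.toLin'_apply]
    have hLdet : ((LinearEquiv.det L : Fˣ) : F) = A.det := by
      rw [LinearEquiv.coe_det, show (L : (Fin 2 → F) →ₗ[F] (Fin 2 → F)) = Matrix.toLin' A from rfl, LinearMap.det_toLin']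
    have hint : ∀ y, g (!![v 0, v 1, 0; v 2, v 3, 0; 0, 0, v 4] * !![1, 0, y 0; 0, 1, y 1; 0, 0, 1]) = P7 v (L y) := fun y => by
      rw [leviMatrix_mul_unipotentMatrix, hLapp]
    simp_rw [hint]
    rw [Literature.MeasureTheory.Group.lintegral_comp_linearEquiv (Measure.pi fun _ : Fin 2 => dx) L (P7 v),
      UnitaryGroup.distribHaarChar_eq_normAbs F (LinearEquiv.det L), hLdet, ENNReal.coe_inv ((map_ne_zero (normAbs F)).2 hv), map_inv₀,
      ENNReal.coe_inv ((map_ne_zero (normAbs F)).2 hv)]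
  -- STEP 4: assemble on `F⁵ × F²` and recombine to `F⁷`
  have hH : Measurable fun r : Fin 7 → F => {r : Fin 7 → F | (!![r 0, r 1; r 3, r 4] : Matrix (Fin 2) (Fin 2) F).det ≠ 0 ∧ r 6 ≠ 0}.indicator
      (fun r => g !![r 0, r 1, r 2; r 3, r 4, r 5; 0, 0, r 6] *
        (((normAbs F ((!![r 0, r 1; r 3, r 4] : Matrix (Fin 2) (Fin 2) F).det)⁻¹ : ℝ≥0) : ℝ≥0∞) ^ 3 * ((normAbs F (r 6)⁻¹ : ℝ≥0) : ℝ≥0∞))) r := by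
    have hA : Continuous fun r : Fin 7 → F => (!![r 0, r 1; r 3, r 4] : Matrix (Fin 2) (Fin 2) F) := by
      refine continuous_matrix fun i j => ?_
      fin_cases i <;> fin_cases j <;> simp <;> fun_prop
    have hP : Continuous fun r : Fin 7 → F => (!![r 0, r 1, r 2; r 3, r 4, r 5; 0, 0, r 6] : Matrix (Fin 3) (Fin 3) F) := by
      refine continuous_matrix fun i j => ?_
      fin_cases i <;> fin_cases j <;> simp <;> fun_prop
    have hdet : Continuous fun r : Fin 7 → F => (!![r 0, r 1; r 3, r 4] : Matrix (Fin 2) (Fin 2) F).det := hA.matrix_det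
    have hw1 : Measurable fun r : Fin 7 → F => ((normAbs F ((!![r 0, r 1; r 3, r 4] : Matrix (Fin 2) (Fin 2) F).det)⁻¹ : ℝ≥0) : ℝ≥0∞) := by
      simp_rw [map_inv₀]
      exact ((LocalFieldHaar.continuous_normAbs.comp hdet).measurable.inv).coe_nnreal_ennreal
    have hw2 : Measurable fun r : Fin 7 → F => ((normAbs F (r 6)⁻¹ : ℝ≥0) : ℝ≥0∞) := by
      simp_rw [map_inv₀]
      exact ((LocalFieldHaar.continuous_normAbs.comp (continuous_apply 6)).measurable.inv).coe_nnreal_ennreal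
    have hS : MeasurableSet {r : Fin 7 → F | (!![r 0, r 1; r 3, r 4] : Matrix (Fin 2) (Fin 2) F).det ≠ 0 ∧ r 6 ≠ 0} :=
      (hdet.measurable (measurableSet_singleton 0).compl).inter ((measurable_pi_apply 6) (measurableSet_singleton 0).compl)
    exact ((hg.comp hP.measurable).mul ((hw1.pow_const 3).mul hw2)).indicator hS
  rw [h1, h2, lintegral_pi_fin_seven_eq dx _ hH, mul_assoc]
  congr 1
  -- pull `C₀` and the substitution factor through, pointwise in `v`
  rw [← lintegral_const_mul' C₀ _ hC₀top]
  refine lintegral_congr fun v => ?_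
  -- membership of the recombined vector `(v₀, v₁, y₀, v₂, v₃, y₁, v₄)` in the open set is membership of `v`
  have hx : ∀ y : Fin 2 → F, (![v 0, v 1, y 0, v 2, v 3, y 1, v 4] : Fin 7 → F) ∈
      {r : Fin 7 → F | (!![r 0, r 1; r 3, r 4] : Matrix (Fin 2) (Fin 2) F).det ≠ 0 ∧ r 6 ≠ 0} ↔
      v ∈ {v : Fin 5 → F | (!![v 0, v 1; v 2, v 3] : Matrix (Fin 2) (Fin 2) F).det ≠ 0 ∧ v 4 ≠ 0} := fun y => by
    simp
  by_cases hv : v ∈ {v : Fin 5 → F | (!![v 0, v 1; v 2, v 3] : Matrix (Fin 2) (Fin 2) F).det ≠ 0 ∧ v 4 ≠ 0}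
  · -- on the open set: `ψ(diag v) = C₀ ‖det A‖⁻¹ ∫ P7 v x dx`, and the indicator is `1`
    have hv' : (!![v 0, v 1; v 2, v 3] : Matrix (Fin 2) (Fin 2) F).det ≠ 0 ∧ v 4 ≠ 0 := hv
    rw [Set.indicator_of_mem hv, hψ]
    beta_reduce
    rw [h3 v hv'.1]
    have hR : ∫⁻ y : Fin 2 → F, {r : Fin 7 → F | (!![r 0, r 1; r 3, r 4] : Matrix (Fin 2) (Fin 2) F).det ≠ 0 ∧ r 6 ≠ 0}.indicator
        (fun r => g !![r 0, r 1, r 2; r 3, r 4, r 5; 0, 0, r 6] *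
          (((normAbs F ((!![r 0, r 1; r 3, r 4] : Matrix (Fin 2) (Fin 2) F).det)⁻¹ : ℝ≥0) : ℝ≥0∞) ^ 3 * ((normAbs F (r 6)⁻¹ : ℝ≥0) : ℝ≥0∞)))
          (![v 0, v 1, y 0, v 2, v 3, y 1, v 4] : Fin 7 → F) ∂(Measure.pi fun _ : Fin 2 => dx) =
        ∫⁻ y : Fin 2 → F, P7 v y *
          (((normAbs F ((!![v 0, v 1; v 2, v 3] : Matrix (Fin 2) (Fin 2) F).det)⁻¹ : ℝ≥0) : ℝ≥0∞) ^ 3 * ((normAbs F (v 4)⁻¹ : ℝ≥0) : ℝ≥0∞))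
          ∂(Measure.pi fun _ : Fin 2 => dx) := by
      refine lintegral_congr fun y => ?_
      rw [Set.indicator_of_mem ((hx y).2 hv)]
      simp [hP7]
    rw [hR, lintegral_mul_const' _ _ (ENNReal.mul_ne_top (ENNReal.pow_ne_top ENNReal.coe_ne_top) ENNReal.coe_ne_top)]
    ring
  · rw [Set.indicator_of_notMem hv]
    have hR : ∫⁻ y : Fin 2 → F, {r : Fin 7 → F | (!![r 0, r 1; r 3, r 4] : Matrix (Fin 2) (Fin 2) F).det ≠ 0 ∧ r 6 ≠ 0}.indicator
        (fun r => g !![r 0, r 1, r 2; r 3, r 4, r 5; 0, 0, r 6] *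
          (((normAbs F ((!![r 0, r 1; r 3, r 4] : Matrix (Fin 2) (Fin 2) F).det)⁻¹ : ℝ≥0) : ℝ≥0∞) ^ 3 * ((normAbs F (r 6)⁻¹ : ℝ≥0) : ℝ≥0∞)))
          (![v 0, v 1, y 0, v 2, v 3, y 1, v 4] : Fin 7 → F) ∂(Measure.pi fun _ : Fin 2 => dx) = ∫⁻ _y : Fin 2 → F, 0 ∂(Measure.pi fun _ : Fin 2 => dx) :=
      lintegral_congr fun y => Set.indicator_of_notMem (fun h => hv ((hx y).1 h)) _
    rw [hR, lintegral_zero, mul_zero]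

end Summit.HodgeConjecture.HodgeConjecture.Cruxes.H413.K2E3GL3ParabolicLeviUnipotentCoordinates

end
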